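import Literature.NumberTheory.Rogawski1990.ArchBouazizClassTubeG        -- ★ p851609 (LH3-p04 (g7)): `exp_add_exp_neg_sub_one_le_norm_fst_of_mem`, brings F0 `bzClassMapG_apply`, `chartEigG_of_(not_)mem`, `esymm3_apply`, `boostEig_eq_mul`
import Literature.NumberTheory.Rogawski1990.ArchBouazizClassMapWallTube   -- ★ (LH3-p04 (g5)): `exists_int_abs_sub_le_of_circleExp`, `circleExp_add_int_mul_two_pi`
import HarnessLib

/-!
# The class tube at a WALL class `esymm3 (u, u, v)`: nearby bounded triples are a permutation of an `ε`-perturbation of `(u, u, v)`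
# (continuity of the roots of a monic cubic at a double root; Rogawski 1990 §3.6, §4.3, §8.2; Bouaziz 1994 §5.1; Shelstad 1979 §4)

Topic `NumberTheory/Rogawski1990`; namespace `Literature.NumberTheory.Rogawski1990`.  THEOREMS ONLY (no `def`, no instance, no notation, no axiom,
no named fact, no `sorry`); lane `--kind proof --supports stmt-HodgeConjecture-24833`.  Cell `pub/hodgecm-mathlib`, crux H413 (`stmt-HodgeConjecture-24833`),
road «N8-INNER» ROAD B, brick (8e′) «WALL EP GENERATOR AT THE COMPACT-WALL REPRESENTATIVE», file (β) of the binder's SIGSHEET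
`SIGSHEET-8e-compact.v1.LH1p01g12.md` (c193f7827509a61e; binder LH1-p01 (g12), dealer LH2-plan (g1) 17:09:24Z «(β) → F0P2-p02 (g21)»).
Author F0P2-p02 (g21).  Count-neutral.

THE MATHEMATICS.  ★ `ArchBouazizClassTubeG` treats REGULAR base classes and ★ `ArchCornerClassTube` the scalar corner `(ζ, ζ, ζ)`; this file is the
remaining case, a WALL class `b = esymm3 (u, u, v)` with `u ≠ v`.  If `l : Fin 3 → ℂ` is bounded (`‖l i‖ ≤ B`) and `dist (esymm3 l) b < δ` (sup distance on
`ℂ × ℂ × ℂ`), then — Vieta — every `l i` is a root of `X³ − σ₁X² + σ₂X − σ₃`, so `(l i − u)²(l i − v) = (σ₁ − σ₁(b)) l_i² − (σ₂ − σ₂(b)) l_i + (σ₃ − σ₃(b))` has modulus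
`≤ δ (B² + |B| + 1)`: each `l i` is `ε`-close to `u` or to `v` (§1).  The COUNT is read off `σ₁ = l₀ + l₁ + l₂ ≈ 2u + v`: with `4ε ≤ ‖u − v‖` exactly two of the
`l i` are near `u` and one is near `v`, i.e. `l ∘ τ` is `ε`-close to `(u, u, v)` for a slot permutation `τ` (§2, `exists_wallTube_esymm3`).  Read on the class data
`bzClassMapG S′ c w = esymm3 (chartEigG S′ c w)` of the `G`-atlas at the wall class of `(e^{iθ₀}, e^{iθ₀}, e^{iφ₀})`:
* at a COMPACT place `w ∉ S′` (§3, `exists_wallTube_bzClassMapG_of_not_mem`) the three angles `c w (τ k)` are, modulo `2π`, `ε`-close to `(θ₀, θ₀, φ₀)`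
  (angles lifted through `Circle.exp` by ★ `exists_int_abs_sub_le_of_circleExp`);
* at a NONCOMPACT place `w ∈ S′` (§3, `exists_wallTube_bzClassMapG_of_mem`) the boost eigenvalues `e^{±x + iφ}` share their argument, so they cannot approximate
  the two DISTINCT unimodular numbers `u, v` (their moduli would both be `ε`-close to `1`, forcing `‖u − v‖ < 4ε`); hence `e^{iψ}` is the eigenvalue near `v`, both
  `e^{±x+iφ}` are near `u`, and `e^{iφ}` — which lies on the segment between them — is near `u` as well (convexity of the ball).
These are the localisation inputs of the wall EP generator (δ) `ArchEPGeneratorWall` («class near `b` ⇒ phases near a permutation of `(θ₀, θ₀, φ₀)`»).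
HONEST LABEL: HC_CM is proved only modulo the 7 printed citations (2 remaining: hLiu418 = stmt-HodgeConjecture-24832, h413 = stmt-HodgeConjecture-24833) until
rung 0 closes; root continuity of a cubic, pays nothing by itself.

## References
* [Rogawski1990] J. D. Rogawski, *Automorphic Representations of Unitary Groups in Three Variables*, Ann. of Math. Stud. 123 (1990), §3.6 p. 28, §4.3 p. 42, §8.2 p. 122.
* [Bouaziz1994IntegralesOrbitales] A. Bouaziz, *Intégrales orbitales sur les groupes de Lie réductifs*, Ann. Sci. ÉNS (4) 27 (1994) 573–609, §5.1 p. 588.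
* [Shelstad1979] D. Shelstad, *Characters and inner forms of a quasi-split group over ℝ*, Compositio Math. 39 (1979), §4 pp. 22–23.
-/

set_option autoImplicit false

noncomputable section

open Complex Set Function Metric
open Literature.NumberTheory.Automorphic Literature.NumberTheory.Automorphic.UnitaryGroup Literature.NumberTheory.Automorphic.ArchCartan

namespace Literature.NumberTheory.Rogawski1990

/-! ## §1 Root localisation near the double root -/

section Roots

/-- **Vieta at a wall class**: for every slot `i`, `(l i − u)²(l i − v) = (σ₁ − σ₁(b)) l_i² − (σ₂ − σ₂(b)) l_i + (σ₃ − σ₃(b))` with `σ = esymm3 l`, `b = (u,u,v)`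
(`l i` is a root of its own cubic `X³ − σ₁X² + σ₂X − σ₃`). [cite: Rogawski1990, §4.3 p. 42] -/
theorem sq_mul_sub_eq_of_esymm3 (l : Fin 3 → ℂ) (u v : ℂ) (i : Fin 3) :
    (l i - u) ^ 2 * (l i - v) =
      ((esymm3 l).1 - (esymm3 ![u, u, v]).1) * l i ^ 2 - ((esymm3 l).2.1 - (esymm3 ![u, u, v]).2.1) * l i + ((esymm3 l).2.2 - (esymm3 ![u, u, v]).2.2) := by
  have h0 : (l i - l 0) * (l i - l 1) * (l i - l 2) = 0 := by fin_cases i <;> simp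
  simp only [esymm3_apply, Matrix.cons_val_zero, Matrix.cons_val_one, Matrix.cons_val_two, Matrix.head_cons, Matrix.tail_cons]
  linear_combination h0

/-- A component of a point of `ℂ × ℂ × ℂ` is within the sup distance: first entry. [folklore] -/
private theorem norm_fst_sub_fst_le (P Q : ℂ × ℂ × ℂ) : ‖P.1 - Q.1‖ ≤ dist P Q := by
  rw [← dist_eq_norm, Prod.dist_eq (x := P)]; exact le_max_left _ _

/-- Second entry. [folklore] -/
private theorem norm_snd_fst_sub_le (P Q : ℂ × ℂ × ℂ) : ‖P.2.1 - Q.2.1‖ ≤ dist P Q := by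
  rw [← dist_eq_norm, Prod.dist_eq (x := P), Prod.dist_eq (x := P.2)]; exact (le_max_left _ _).trans (le_max_right _ _)

/-- Third entry. [folklore] -/
private theorem norm_snd_snd_sub_le (P Q : ℂ × ℂ × ℂ) : ‖P.2.2 - Q.2.2‖ ≤ dist P Q := by
  rw [← dist_eq_norm, Prod.dist_eq (x := P), Prod.dist_eq (x := P.2)]; exact (le_max_right _ _).trans (le_max_right _ _)

/-- **Root estimate at a wall class**: `‖(l i − u)²(l i − v)‖ ≤ dist (esymm3 l) (esymm3 (u,u,v)) · (‖l i‖² + ‖l i‖ + 1)`. [cite: Rogawski1990, §4.3 p. 42]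
[cite: Bouaziz1994IntegralesOrbitales, §5.1 p. 588] -/
theorem norm_sq_mul_sub_le_of_esymm3 (l : Fin 3 → ℂ) (u v : ℂ) (i : Fin 3) :
    ‖(l i - u) ^ 2 * (l i - v)‖ ≤ dist (esymm3 l) (esymm3 ![u, u, v]) * (‖l i‖ ^ 2 + ‖l i‖ + 1) := by
  rw [sq_mul_sub_eq_of_esymm3]
  set d : ℝ := dist (esymm3 l) (esymm3 ![u, u, v]) with hd
  have h1 := norm_fst_sub_fst_le (esymm3 l) (esymm3 ![u, u, v])
  have h2 := norm_snd_fst_sub_le (esymm3 l) (esymm3 ![u, u, v])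
  have h3 := norm_snd_snd_sub_le (esymm3 l) (esymm3 ![u, u, v])
  calc ‖((esymm3 l).1 - (esymm3 ![u, u, v]).1) * l i ^ 2 - ((esymm3 l).2.1 - (esymm3 ![u, u, v]).2.1) * l i + ((esymm3 l).2.2 - (esymm3 ![u, u, v]).2.2)‖
      ≤ ‖((esymm3 l).1 - (esymm3 ![u, u, v]).1) * l i ^ 2 - ((esymm3 l).2.1 - (esymm3 ![u, u, v]).2.1) * l i‖ + ‖(esymm3 l).2.2 - (esymm3 ![u, u, v]).2.2‖ :=
        norm_add_le _ _
    _ ≤ ‖((esymm3 l).1 - (esymm3 ![u, u, v]).1) * l i ^ 2‖ + ‖((esymm3 l).2.1 - (esymm3 ![u, u, v]).2.1) * l i‖ + ‖(esymm3 l).2.2 - (esymm3 ![u, u, v]).2.2‖ := by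
        gcongr; exact norm_sub_le _ _
    _ = ‖(esymm3 l).1 - (esymm3 ![u, u, v]).1‖ * ‖l i‖ ^ 2 + ‖(esymm3 l).2.1 - (esymm3 ![u, u, v]).2.1‖ * ‖l i‖ + ‖(esymm3 l).2.2 - (esymm3 ![u, u, v]).2.2‖ := by
        rw [norm_mul, norm_mul, norm_pow]
    _ ≤ d * ‖l i‖ ^ 2 + d * ‖l i‖ + d := by gcongr
    _ = d * (‖l i‖ ^ 2 + ‖l i‖ + 1) := by ring

end Roots

/-! ## §2 The wall tube for bounded triples -/

section WallTube

/-- **THE CLASS TUBE AT A WALL CLASS (bounded triples).**  For `u ≠ v`, a bound `B` and `ε > 0` there is `δ > 0` such that every `l : Fin 3 → ℂ` with `‖l i‖ ≤ B` and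
`dist (esymm3 l) (esymm3 (u, u, v)) < δ` is, after a slot permutation `τ`, `ε`-close to `(u, u, v)`: `‖l (τ 0) − u‖, ‖l (τ 1) − u‖, ‖l (τ 2) − v‖ < ε`
(roots of a monic cubic near `(X − u)²(X − v)`: each root is near `u` or `v` by §1, and `σ₁ ≈ 2u + v` counts two near `u`, one near `v`).
[cite: Rogawski1990, §3.6 p. 28; §4.3 p. 42] [cite: Bouaziz1994IntegralesOrbitales, §5.1 p. 588] [cite: Shelstad1979, §4 pp. 22–23] -/
theorem exists_wallTube_esymm3 {u v : ℂ} (huv : u ≠ v) (B : ℝ) {ε : ℝ} (hε : 0 < ε) :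
    ∃ δ > (0 : ℝ), ∀ l : Fin 3 → ℂ, (∀ i, ‖l i‖ ≤ B) → dist (esymm3 l) (esymm3 ![u, u, v]) < δ →
      ∃ τ : Equiv.Perm (Fin 3), ‖l (τ 0) - u‖ < ε ∧ ‖l (τ 1) - u‖ < ε ∧ ‖l (τ 2) - v‖ < ε := by
  have huv0 : 0 < ‖u - v‖ := norm_pos_iff.2 (sub_ne_zero.2 huv)
  -- the working radius `ε₁ ≤ ε` with `4ε₁ ≤ ‖u − v‖`
  set ε₁ : ℝ := min ε (‖u - v‖ / 4) with hε₁
  have hε₁0 : 0 < ε₁ := lt_min hε (by positivity)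
  have hε₁ε : ε₁ ≤ ε := min_le_left _ _
  have hε₁4 : 4 * ε₁ ≤ ‖u - v‖ := by
    have := min_le_right ε (‖u - v‖ / 4)
    linarith
  set K : ℝ := B ^ 2 + |B| + 1 with hK
  have hK0 : 0 < K := by positivity
  refine ⟨min ε₁ (ε₁ ^ 3 / K), lt_min hε₁0 (by positivity), fun l hl hd => ?_⟩
  set d : ℝ := dist (esymm3 l) (esymm3 ![u, u, v]) with hd_def
  have hdε₁ : d < ε₁ := hd.trans_le (min_le_left _ _)
  have hdK : d * K < ε₁ ^ 3 := by
    have h := hd.trans_le (min_le_right _ _)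
    rwa [lt_div_iff₀ hK0] at h
  -- §1: each root is `ε₁`-near `u` or `v`
  have near : ∀ i, ‖l i - u‖ < ε₁ ∨ ‖l i - v‖ < ε₁ := by
    intro i
    by_contra h
    rw [not_or, not_lt, not_lt] at h
    obtain ⟨hu, hv⟩ := h
    have hzB : ‖l i‖ ≤ |B| := (hl i).trans (le_abs_self B)
    have hz2 : ‖l i‖ ^ 2 ≤ B ^ 2 := by
      rw [← sq_abs B]
      exact pow_le_pow_left₀ (norm_nonneg _) hzB 2
    have hle : ‖(l i - u) ^ 2 * (l i - v)‖ ≤ d * K := by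
      refine (norm_sq_mul_sub_le_of_esymm3 l u v i).trans ?_
      rw [← hd_def, hK]
      exact mul_le_mul_of_nonneg_left (by linarith) dist_nonneg
    have hge : ε₁ ^ 3 ≤ ‖(l i - u) ^ 2 * (l i - v)‖ := by
      rw [norm_mul, norm_pow]
      calc ε₁ ^ 3 = ε₁ ^ 2 * ε₁ := by ring
        _ ≤ ‖l i - u‖ ^ 2 * ‖l i - v‖ := by gcongr
    linarith
  -- the count via `σ₁ = l₀ + l₁ + l₂ ≈ 2u + v`
  have hs : ‖(l 0 + l 1 + l 2) - (2 * u + v)‖ < ε₁ := by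
    have h1 := norm_fst_sub_fst_le (esymm3 l) (esymm3 ![u, u, v])
    simp only [esymm3_apply, Matrix.cons_val_zero, Matrix.cons_val_one, Matrix.cons_val_two, Matrix.head_cons, Matrix.tail_cons] at h1
    rw [show (2 : ℂ) * u + v = u + u + v by ring]
    exact h1.trans_lt hdε₁
  -- the contradiction device for the six∕five wrong patterns: `w = s − a − b − c` with `‖u − v‖ ≤ ‖w‖` is impossible
  have far : ∀ a b c w : ℂ, ‖a‖ < ε₁ → ‖b‖ < ε₁ → ‖c‖ < ε₁ → ‖u - v‖ ≤ ‖w‖ →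
      w = ((l 0 + l 1 + l 2) - (2 * u + v)) - a - b - c → False := by
    intro a b c w ha hb hc hw h
    have hle : ‖w‖ ≤ ‖(l 0 + l 1 + l 2) - (2 * u + v)‖ + ‖a‖ + ‖b‖ + ‖c‖ := by
      rw [h]
      calc ‖(l 0 + l 1 + l 2) - (2 * u + v) - a - b - c‖ ≤ ‖(l 0 + l 1 + l 2) - (2 * u + v) - a - b‖ + ‖c‖ := norm_sub_le _ _
        _ ≤ ‖(l 0 + l 1 + l 2) - (2 * u + v) - a‖ + ‖b‖ + ‖c‖ := by gcongr; exact norm_sub_le _ _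
        _ ≤ ‖(l 0 + l 1 + l 2) - (2 * u + v)‖ + ‖a‖ + ‖b‖ + ‖c‖ := by gcongr; exact norm_sub_le _ _
    linarith
  have hvu : ‖u - v‖ ≤ ‖v - u‖ := (norm_sub_rev u v).le
  have hvu2 : ‖u - v‖ ≤ ‖2 * (v - u)‖ := by
    rw [norm_mul, Complex.norm_two, norm_sub_rev v u]
    linarith
  -- the permutation values used below
  obtain ⟨s12_0, s12_1, s12_2⟩ : Equiv.swap (1 : Fin 3) 2 0 = 0 ∧ Equiv.swap (1 : Fin 3) 2 1 = 2 ∧ Equiv.swap (1 : Fin 3) 2 2 = 1 := by decide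
  obtain ⟨s02_0, s02_1, s02_2⟩ : Equiv.swap (0 : Fin 3) 2 0 = 2 ∧ Equiv.swap (0 : Fin 3) 2 1 = 1 ∧ Equiv.swap (0 : Fin 3) 2 2 = 0 := by decide
  rcases near 0 with h0 | h0 <;> rcases near 1 with h1 | h1 <;> rcases near 2 with h2 | h2
  · -- (u,u,u): `σ₁ − (2u+v) − Σ (l_i − u) = u − v`
    exact (far _ _ _ (u - v) h0 h1 h2 le_rfl (by ring)).elim
  · -- (u,u,v): the identity
    exact ⟨1, by simpa using h0.trans_le hε₁ε, by simpa using h1.trans_le hε₁ε, by simpa using h2.trans_le hε₁ε⟩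
  · -- (u,v,u): swap the slots `1, 2`
    refine ⟨Equiv.swap 1 2, ?_, ?_, ?_⟩
    · rw [s12_0]; exact h0.trans_le hε₁ε
    · rw [s12_1]; exact h2.trans_le hε₁ε
    · rw [s12_2]; exact h1.trans_le hε₁ε
  · -- (u,v,v)
    exact (far _ _ _ (v - u) h0 h1 h2 hvu (by ring)).elim
  · -- (v,u,u): swap the slots `0, 2`
    refine ⟨Equiv.swap 0 2, ?_, ?_, ?_⟩
    · rw [s02_0]; exact h2.trans_le hε₁ε
    · rw [s02_1]; exact h1.trans_le hε₁ε
    · rw [s02_2]; exact h0.trans_le hε₁ε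
  · -- (v,u,v)
    exact (far _ _ _ (v - u) h0 h1 h2 hvu (by ring)).elim
  · -- (v,v,u)
    exact (far _ _ _ (v - u) h0 h1 h2 hvu (by ring)).elim
  · -- (v,v,v)
    exact (far _ _ _ (2 * (v - u)) h0 h1 h2 hvu2 (by ring)).elim

end WallTube

/-! ## §3 The wall tube read on the `G`-atlas class data, both chart types -/

section Atlas

variable {W : Type*} [DecidableEq W]

/-- **COMPACT PLACE: class `δ`-near the wall class of `(e^{iθ₀}, e^{iθ₀}, e^{iφ₀})` ⇒ the three angles are, after a slot permutation and modulo `2π`, `ε`-near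
`(θ₀, θ₀, φ₀)`** (`w ∉ S′`: `chartEigG S′ c w = (e^{i c_{w,k}})_k` is unimodular, §2 with `B = 1`, then each angle is lifted through `Circle.exp` by ★
`exists_int_abs_sub_le_of_circleExp`). [cite: Shelstad1979, §4 pp. 22–23] [cite: Rogawski1990, §8.2 p. 122] [cite: Bouaziz1994IntegralesOrbitales, §5.1 p. 588] -/
theorem exists_wallTube_bzClassMapG_of_not_mem {S' : Finset W} {w : W} (hw : w ∉ S') (θ₀ φ₀ : ℝ)
    (hne : Complex.exp ((θ₀ : ℂ) * I) ≠ Complex.exp ((φ₀ : ℂ) * I)) {ε : ℝ} (hε : 0 < ε) :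
    ∃ δ > (0 : ℝ), ∀ c : W → Fin 3 → ℝ,
      dist (bzClassMapG S' c w) (esymm3 ![Complex.exp ((θ₀ : ℂ) * I), Complex.exp ((θ₀ : ℂ) * I), Complex.exp ((φ₀ : ℂ) * I)]) < δ →
        ∃ (τ : Equiv.Perm (Fin 3)) (x : Fin 3 → ℝ), ‖x‖ < ε ∧ ∀ k, Circle.exp (c w (τ k)) = Circle.exp (![θ₀, θ₀, φ₀] k + x k) := by
  obtain ⟨δ, hδ, hT⟩ := exists_wallTube_esymm3 hne 1 (half_pos hε)
  refine ⟨δ, hδ, fun c hc => ?_⟩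
  rw [bzClassMapG_apply, chartEigG_of_not_mem hw] at hc
  obtain ⟨τ, h0, h1, h2⟩ := hT (fun i => Complex.exp ((c w i : ℂ) * I)) (fun i => (Complex.norm_exp_ofReal_mul_I _).le) hc
  -- the three chords, in the `Circle.exp` spelling
  have c0 : ‖(Circle.exp (c w (τ 0)) : ℂ) - (Circle.exp (![θ₀, θ₀, φ₀] 0) : ℂ)‖ < ε / 2 := by rw [Circle.coe_exp, Circle.coe_exp]; exact h0
  have c1 : ‖(Circle.exp (c w (τ 1)) : ℂ) - (Circle.exp (![θ₀, θ₀, φ₀] 1) : ℂ)‖ < ε / 2 := by rw [Circle.coe_exp, Circle.coe_exp]; exact h1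
  have c2 : ‖(Circle.exp (c w (τ 2)) : ℂ) - (Circle.exp (![θ₀, θ₀, φ₀] 2) : ℂ)‖ < ε / 2 := by rw [Circle.coe_exp, Circle.coe_exp]; exact h2
  have chord : ∀ k : Fin 3, ‖(Circle.exp (c w (τ k)) : ℂ) - (Circle.exp (![θ₀, θ₀, φ₀] k) : ℂ)‖ < ε / 2 := by
    intro k
    fin_cases k
    exacts [c0, c1, c2]
  -- lift each angle through `Circle.exp`
  choose n hn using fun k : Fin 3 => exists_int_abs_sub_le_of_circleExp (c w (τ k)) (![θ₀, θ₀, φ₀] k)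
  refine ⟨τ, fun k => c w (τ k) - (![θ₀, θ₀, φ₀] k + n k * (2 * Real.pi)), ?_, ?_⟩
  · rw [pi_norm_lt_iff hε]
    intro k
    rw [Real.norm_eq_abs]
    have h1 := hn k
    have h2 := chord k
    nlinarith [Real.pi_le_four, Real.pi_pos, norm_nonneg ((Circle.exp (c w (τ k)) : ℂ) - (Circle.exp (![θ₀, θ₀, φ₀] k) : ℂ))]
  · intro k
    have h : ![θ₀, θ₀, φ₀] k + (c w (τ k) - (![θ₀, θ₀, φ₀] k + n k * (2 * Real.pi))) = c w (τ k) + ((-(n k) : ℤ) : ℝ) * (2 * Real.pi) := by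
      push_cast
      ring
    rw [h, circleExp_add_int_mul_two_pi]

/-- Two numbers on a common ray through two points `ε`-close to DISTINCT unimodular `u, v` with `4ε ≤ ‖u − v‖`: impossible (`|a − 1|, |b − 1| < ε` ⇒ `‖ap − bp‖ < 2ε`).
[cite: Rogawski1990, §3.6 p. 28] -/
private theorem false_of_ray_near_two {p u v : ℂ} (hp : ‖p‖ = 1) (hu : ‖u‖ = 1) (hv : ‖v‖ = 1) {a b ε : ℝ} (ha0 : 0 ≤ a) (hb0 : 0 ≤ b)
    (huv : 4 * ε ≤ ‖u - v‖) (ha : ‖(a : ℂ) * p - u‖ < ε) (hb : ‖(b : ℂ) * p - v‖ < ε) : False := by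
  have hna : ‖(a : ℂ) * p‖ = a := by rw [norm_mul, Complex.norm_real, Real.norm_eq_abs, abs_of_nonneg ha0, hp, mul_one]
  have hnb : ‖(b : ℂ) * p‖ = b := by rw [norm_mul, Complex.norm_real, Real.norm_eq_abs, abs_of_nonneg hb0, hp, mul_one]
  have ha1 : |a - 1| < ε := by
    have h := abs_norm_sub_norm_le ((a : ℂ) * p) u
    rw [hna, hu] at h
    exact h.trans_lt ha
  have hb1 : |b - 1| < ε := by
    have h := abs_norm_sub_norm_le ((b : ℂ) * p) v
    rw [hnb, hv] at h
    exact h.trans_lt hb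
  have hab : ‖(a : ℂ) * p - (b : ℂ) * p‖ = |a - b| := by
    rw [← sub_mul, norm_mul, hp, mul_one, ← Complex.ofReal_sub, Complex.norm_real, Real.norm_eq_abs]
  have hle : ‖u - v‖ ≤ ‖(a : ℂ) * p - u‖ + ‖(a : ℂ) * p - (b : ℂ) * p‖ + ‖(b : ℂ) * p - v‖ := by
    calc ‖u - v‖ = ‖((a : ℂ) * p - (b : ℂ) * p) + ((b : ℂ) * p - v) - ((a : ℂ) * p - u)‖ := by ring_nf
      _ ≤ ‖((a : ℂ) * p - (b : ℂ) * p) + ((b : ℂ) * p - v)‖ + ‖(a : ℂ) * p - u‖ := norm_sub_le _ _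
      _ ≤ ‖(a : ℂ) * p - (b : ℂ) * p‖ + ‖(b : ℂ) * p - v‖ + ‖(a : ℂ) * p - u‖ := by gcongr; exact norm_add_le _ _
      _ = _ := by ring
  rw [hab] at hle
  have hab2 : |a - b| < 2 * ε := by
    rw [show a - b = (a - 1) - (b - 1) by ring]
    exact (abs_sub _ _).trans_lt (by linarith)
  linarith

/-- A convex combination of two numbers `< ε` is `< ε`. [folklore] -/
private theorem convex_comb_lt {s t X Y ε : ℝ} (hs : 0 ≤ s) (ht : 0 ≤ t) (hst : s + t = 1) (hX : X < ε) (hY : Y < ε) : s * X + t * Y < ε := by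
  have hX' : s * (X - ε) ≤ 0 := mul_nonpos_iff.2 (Or.inl ⟨hs, by linarith⟩)
  have hY' : t * (Y - ε) ≤ 0 := mul_nonpos_iff.2 (Or.inl ⟨ht, by linarith⟩)
  have key : s * X + t * Y = s * (X - ε) + t * (Y - ε) + (s + t) * ε := by ring
  rw [key, hst, one_mul]
  rcases hs.eq_or_lt with h | h
  · subst h
    rw [zero_add] at hst
    subst hst
    linarith
  · have hX'' : s * (X - ε) < 0 := mul_neg_of_pos_of_neg h (by linarith)
    linarith

/-- Convex weights putting `1` between `a` and `b = a⁻¹`: `s b + t a = 1`, `s, t ≥ 0`, `s + t = 1`. [folklore] -/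
private theorem exists_convex_weights {a b : ℝ} (ha : 0 < a) (hab : a * b = 1) :
    ∃ s t : ℝ, 0 ≤ s ∧ 0 ≤ t ∧ s + t = 1 ∧ s * b + t * a = 1 := by
  by_cases h1 : a = 1
  · subst h1
    rw [one_mul] at hab
    exact ⟨1, 0, zero_le_one, le_rfl, by ring, by rw [hab]; ring⟩
  have hb : 0 < b := by nlinarith
  have hne : a - b ≠ 0 := by
    intro h
    have hb' : b = a := by linarith
    rw [hb'] at hab
    rcases mul_self_eq_one_iff.1 hab with h' | h'
    · exact h1 h'
    · linarith
  refine ⟨(a - 1) / (a - b), (1 - b) / (a - b), ?_, ?_, ?_, ?_⟩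
  · rcases lt_or_gt_of_ne h1 with hlt | hgt
    · have hb1 : 1 < b := by nlinarith
      exact div_nonneg_of_nonpos (by linarith) (by linarith)
    · have hb1 : b < 1 := by nlinarith
      exact div_nonneg (by linarith) (by linarith)
  · rcases lt_or_gt_of_ne h1 with hlt | hgt
    · have hb1 : 1 < b := by nlinarith
      exact div_nonneg_of_nonpos (by linarith) (by linarith)
    · have hb1 : b < 1 := by nlinarith
      exact div_nonneg (by linarith) (by linarith)
  · rw [← add_div, show a - 1 + (1 - b) = a - b by ring, div_self hne]
  · rw [div_mul_eq_mul_div, div_mul_eq_mul_div, ← add_div, div_eq_one_iff_eq hne]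
    ring

/-- **`e^{iφ}` between `e^{x+iφ}` and `e^{−x+iφ}`**: if both `a·p` and `b·p` (`a > 0`, `ab = 1`) are `ε`-close to `u`, so is `p` (the ball is convex and `p` lies on the
segment). [cite: Rogawski1990, §3.6 p. 28] -/
private theorem norm_sub_lt_of_ray {p u : ℂ} {a b ε : ℝ} (ha : 0 < a) (hab : a * b = 1) (hA : ‖(a : ℂ) * p - u‖ < ε) (hB : ‖(b : ℂ) * p - u‖ < ε) :
    ‖p - u‖ < ε := by
  obtain ⟨s, t, hs, ht, hst, h1⟩ := exists_convex_weights ha hab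
  have hdec : p - u = (s : ℂ) * ((b : ℂ) * p - u) + (t : ℂ) * ((a : ℂ) * p - u) := by
    have hst' : (s : ℂ) + (t : ℂ) = 1 := by exact_mod_cast hst
    have h1' : (s : ℂ) * (b : ℂ) + (t : ℂ) * (a : ℂ) = 1 := by exact_mod_cast h1
    linear_combination (-p) * h1' + u * hst'
  rw [hdec]
  calc ‖(s : ℂ) * ((b : ℂ) * p - u) + (t : ℂ) * ((a : ℂ) * p - u)‖ ≤ ‖(s : ℂ) * ((b : ℂ) * p - u)‖ + ‖(t : ℂ) * ((a : ℂ) * p - u)‖ := norm_add_le _ _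
    _ = s * ‖(b : ℂ) * p - u‖ + t * ‖(a : ℂ) * p - u‖ := by
        rw [norm_mul, norm_mul, Complex.norm_real, Complex.norm_real, Real.norm_eq_abs, Real.norm_eq_abs, abs_of_nonneg hs, abs_of_nonneg ht]
    _ < ε := convex_comb_lt hs ht hst hB hA

/-- **NONCOMPACT PLACE: class `δ`-near the wall class of `(e^{iθ₀}, e^{iθ₀}, e^{iφ₀})` with `4ε ≤ ‖e^{iθ₀} − e^{iφ₀}‖ ⇒ the boost eigenvalue `e^{x + iφ}` AND the bare
phase `e^{iφ}` are `ε`-near `e^{iθ₀}`** (`w ∈ S′`: `chartEigG = boostEig (c w)`; the split coordinate is bounded on the tube by ★ `exp_add_exp_neg_sub_one_le_norm_fst_of_mem`,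
§2 with `B = 5`; `e^{±x+iφ}` lie on one ray, so they cannot be the two eigenvalues near the distinct `u, v` — both are near `u`, and `e^{iφ}` between them too).
[cite: Rogawski1990, §3.6 p. 28; §8.2 p. 122] [cite: Bouaziz1994IntegralesOrbitales, §5.1 p. 588] -/
theorem exists_wallTube_bzClassMapG_of_mem {S' : Finset W} {w : W} (hw : w ∈ S') (θ₀ φ₀ : ℝ)
    (hne : Complex.exp ((θ₀ : ℂ) * I) ≠ Complex.exp ((φ₀ : ℂ) * I)) {ε : ℝ} (hε : 0 < ε)
    (hε4 : 4 * ε ≤ ‖Complex.exp ((θ₀ : ℂ) * I) - Complex.exp ((φ₀ : ℂ) * I)‖) :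
    ∃ δ > (0 : ℝ), ∀ c : W → Fin 3 → ℝ,
      dist (bzClassMapG S' c w) (esymm3 ![Complex.exp ((θ₀ : ℂ) * I), Complex.exp ((θ₀ : ℂ) * I), Complex.exp ((φ₀ : ℂ) * I)]) < δ →
        ‖Complex.exp ((c w 0 : ℂ) + (c w 2 : ℂ) * I) - Complex.exp ((θ₀ : ℂ) * I)‖ < ε ∧
          ‖Complex.exp ((c w 2 : ℂ) * I) - Complex.exp ((θ₀ : ℂ) * I)‖ < ε := by
  set u : ℂ := Complex.exp ((θ₀ : ℂ) * I) with hu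
  set v : ℂ := Complex.exp ((φ₀ : ℂ) * I) with hv
  have hnu : ‖u‖ = 1 := Complex.norm_exp_ofReal_mul_I _
  have hnv : ‖v‖ = 1 := Complex.norm_exp_ofReal_mul_I _
  obtain ⟨δ, hδ, hT⟩ := exists_wallTube_esymm3 hne 5 hε
  refine ⟨min δ 1, lt_min hδ one_pos, fun c hc => ?_⟩
  have hc1 : dist (bzClassMapG S' c w) (esymm3 ![u, u, v]) < 1 := hc.trans_le (min_le_right _ _)
  have hcδ : dist (bzClassMapG S' c w) (esymm3 ![u, u, v]) < δ := hc.trans_le (min_le_left _ _)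
  -- the split coordinate is bounded on the tube: `eˣ, e⁻ˣ ≤ 5`
  have hσ₁ := exp_add_exp_neg_sub_one_le_norm_fst_of_mem hw c
  have hb1 : ‖(bzClassMapG S' c w).1‖ < 4 := by
    have h1 := norm_fst_sub_fst_le (bzClassMapG S' c w) (esymm3 ![u, u, v])
    have e1 : (esymm3 ![u, u, v]).1 = u + u + v := by
      simp only [esymm3_apply, Matrix.cons_val_zero, Matrix.cons_val_one, Matrix.cons_val_two, Matrix.head_cons, Matrix.tail_cons]
    rw [e1] at h1
    have h3 : ‖u + u + v‖ ≤ 3 := by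
      calc ‖u + u + v‖ ≤ ‖u + u‖ + ‖v‖ := norm_add_le _ _
        _ ≤ ‖u‖ + ‖u‖ + ‖v‖ := by gcongr; exact norm_add_le _ _
        _ = 3 := by rw [hnu, hnv]; norm_num
    have h4 := norm_sub_norm_le (bzClassMapG S' c w).1 (u + u + v)
    linarith
  set a : ℝ := Real.exp (c w 0) with ha_def
  set b : ℝ := Real.exp (-(c w 0)) with hb_def
  have ha0 : 0 < a := Real.exp_pos _
  have hb0 : 0 < b := Real.exp_pos _
  have hab : a * b = 1 := by rw [ha_def, hb_def, ← Real.exp_add, add_neg_cancel, Real.exp_zero]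
  have ha5 : a ≤ 5 := by linarith
  have hb5 : b ≤ 5 := by linarith
  -- the three eigenvalues on the ray of `p = e^{iφ}` and the bare phase `q = e^{iψ}`
  set p : ℂ := Complex.exp ((c w 2 : ℂ) * I) with hp
  have hnp : ‖p‖ = 1 := Complex.norm_exp_ofReal_mul_I _
  have hE : boostEig (c w) = ![(a : ℂ) * p, Complex.exp ((c w 1 : ℂ) * I), (b : ℂ) * p] := by
    rw [boostEig_eq_mul, ha_def, hb_def, Complex.ofReal_exp, Complex.ofReal_exp, Complex.ofReal_neg]
  rw [bzClassMapG_apply, chartEigG_of_mem hw, hE] at hcδ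
  have hB : ∀ i, ‖(![(a : ℂ) * p, Complex.exp ((c w 1 : ℂ) * I), (b : ℂ) * p] : Fin 3 → ℂ) i‖ ≤ 5 := by
    have n0 : ‖(a : ℂ) * p‖ ≤ 5 := by rw [norm_mul, hnp, mul_one, Complex.norm_real, Real.norm_eq_abs, abs_of_pos ha0]; exact ha5
    have n1 : ‖Complex.exp ((c w 1 : ℂ) * I)‖ ≤ 5 := by rw [Complex.norm_exp_ofReal_mul_I]; norm_num
    have n2 : ‖(b : ℂ) * p‖ ≤ 5 := by rw [norm_mul, hnp, mul_one, Complex.norm_real, Real.norm_eq_abs, abs_of_pos hb0]; exact hb5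
    intro i
    fin_cases i
    exacts [n0, n1, n2]
  obtain ⟨τ, h0, h1, h2⟩ := hT _ hB hcδ
  -- the two slots other than `τ 2` carry eigenvalues near `u`
  have hU : ∀ i, i ≠ τ 2 → ‖(![(a : ℂ) * p, Complex.exp ((c w 1 : ℂ) * I), (b : ℂ) * p] : Fin 3 → ℂ) i - u‖ < ε := by
    intro i hi
    obtain ⟨k, rfl⟩ := τ.surjective i
    fin_cases k
    · exact h0
    · exact h1
    · exact absurd rfl hi
  -- the first claim in the `boostEig` spelling
  have hfirst : Complex.exp ((c w 0 : ℂ) + (c w 2 : ℂ) * I) = (a : ℂ) * p := by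
    rw [Complex.exp_add, ha_def, Complex.ofReal_exp]
  rw [hfirst]
  -- which slot is near `v`?
  obtain ⟨j, hj⟩ : ∃ j, τ 2 = j := ⟨_, rfl⟩
  rw [hj] at h2 hU
  fin_cases j
  · -- `τ 2 = 0`: `a·p` near `v` and `b·p` near `u` — impossible
    have hA : ‖(a : ℂ) * p - v‖ < ε := h2
    have hB' : ‖(b : ℂ) * p - u‖ < ε := by simpa only [Matrix.cons_val_two, Matrix.tail_cons, Matrix.head_cons] using hU 2 (by decide)
    exact (false_of_ray_near_two hnp hnu hnv hb0.le ha0.le hε4 hB' hA).elim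
  · -- `τ 2 = 1`: both ray points near `u`
    have hA : ‖(a : ℂ) * p - u‖ < ε := by simpa only [Matrix.cons_val_zero] using hU 0 (by decide)
    have hB' : ‖(b : ℂ) * p - u‖ < ε := by simpa only [Matrix.cons_val_two, Matrix.tail_cons, Matrix.head_cons] using hU 2 (by decide)
    exact ⟨hA, norm_sub_lt_of_ray ha0 hab hA hB'⟩
  · -- `τ 2 = 2`: `b·p` near `v` and `a·p` near `u` — impossible
    have hA : ‖(a : ℂ) * p - u‖ < ε := by simpa only [Matrix.cons_val_zero] using hU 0 (by decide)
    have hB' : ‖(b : ℂ) * p - v‖ < ε := h2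
    exact (false_of_ray_near_two hnp hnu hnv ha0.le hb0.le hε4 hA hB').elim

end Atlas

end Literature.NumberTheory.Rogawski1990

end
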